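import Literature.Analysis.FluidPDE.TaoAnnulusHeatFlux
import Literature.Analysis.FluidPDE.TaoNonlinearEstimate
import HarnessLib

/-!
# Tao (2011/2013), proof of Thm. 10.1 (annular form): the integrated enstrophy inequality

The §10 enstrophy inequality of Tao 2011 (arXiv:1108.1165, proof of Thm. 10.1 = arXiv Thm. 59,
pp. 31–33), in the annular geometry of Remark 10.6 and at unit viscosity, assembled from the
tree's bricks and the vendored nonlinear estimate. Tao: "collecting the bounds for `Y₁, …, Y₆` we
thus have
`∂ₜW ≤ −Y₁ + O(c^{0.05}δ^{-1}W^{1/2}Y₁ + c^{-0.15}δ³W^{3/2} + c^{0.75}W/T + a(t)W^{1/2} + b(t))`"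
(p. 33). Here `f = 0` (so `a = 0`), the cutoff is the moving annular ramp
`η(t) = annularRamp k (R₁' + σ(t)/c) (R₂' − σ(t)/c) ‖· − x₀‖`, `k = c^{-1/10}δ²`,
`σ(t) = ∫₀ᵗ‖u‖_{L^∞}` (`NS.movingCutoff`, `NS.speedIntegral`), and since `σ` is only absolutely
continuous the inequality is established in integrated form:

* `enstrophyProduction_sub_recession_le` — **the inequality at a fixed time**: production minus
  recession `∫⟨ω,∂ₜω⟩η − (k/c)s·½∫_{layers}|ω|² ≤ −Y₁ + K(c^{1/20}δ⁻¹W^{1/2}Y₁ + c^{-3/20}δ³W^{3/2}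
  + c^{3/4}W/T + 0 + b)`, from the identity (10.11) (`integral_enstrophyProduction_mul_weight`),
  the heat-flux bound (`heatFlux_le`, `mul_setIntegral_layer_inv_norm_le`), the transport bound
  `|Y₄| ≲ cY₂` (`integral_norm_sq_mul_lineDeriv_annularRamp_le`: `∫|ω|²∂ᵤη ≤ ks∫_{layers}|ω|²` for
  `|u| ≤ s`, by the a.e. formula for `∇η`), the vendored estimate for `Y₆`
  (`tao2011_nonlinearEstimateWith K`), and the absorption `c + Kc^{9/10} ≤ 1` of `Y₄` and of the
  `Y₂`-part of the `Y₆` bound into the recession term `−Y₂`;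
* `localisedEnstrophy_add_intervalIntegral_le` — **the integrated inequality**
  `W(t) + ∫₀ᵗY₁ ≤ W(0) + ∫₀ᵗ K(…)` for `t ∈ [0, T]`, in exactly the shape consumed by the continuity
  method `NS.tao2011_enstrophy_continuity_step_integral`, from the kinematic identity
  `NS.localisedEnstrophy_movingCutoff_sub_eq` and the fixed-time inequality at almost every time
  (the times at which `|u(t, ·)| ≤ σ'(t) = ‖u(t)‖_{L^∞} < ∞`);
* `continuousOn_heatFluxMajorant` — continuity on `[0, T]` of the heat-flux majorant
  `b(t) = (k/2)(ρ₁²S(ρ₁) + ρ₂²S(ρ₂)) + (k/R₁')∫_{R₁'<‖x−x₀‖<R₂'}|ω|²`.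

## Mathlib / tree search

All Navier–Stokes inputs are tree theorems (`TaoLocalisedEnstrophy`, `TaoEnstrophyIdentity`,
`TaoHeatFlux`, `TaoSpeedIntegral`, `TaoMovingCutoff`, `TaoAnnulusHeatFlux`) except the named fact
`tao2011_nonlinearEstimate(With)` (`TaoNonlinearEstimate.lean`); `lean search
'enstrophy.*inequality|production_sub'` in FluidPDE: no integrated §10 inequality existed.
Mathlib: `HasFDerivAt.hasLineDerivAt`, `HasLineDerivAt.lineDeriv`, `integral_mono_ae`,
`intervalIntegral.integral_mono_ae_restrict`, `ae_restrict_iff'`.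

## References

* T. Tao, *Localisation and compactness properties of the Navier–Stokes global regularity
  problem*, Anal. PDE 6 (2013) 25–107 = arXiv:1108.1165 (`Tao2011`), §10, proof of Thm. 10.1
  ((10.11)–(10.14), (10.19)–(10.23), arXiv pp. 31–33), Remark 10.6 (arXiv Rem. 64).
-/

noncomputable section

open MeasureTheory Set Function Filter intervalIntegral
open scoped ENNReal NNReal Topology RealInnerProductSpace ContDiff

namespace Literature.Analysis.FluidPDE
section Dictionary

variable {x₀ : EuclideanSpace ℝ (Fin 3)} {k : ℝ} {ρ₁ ρ₂ : ℝ → ℝ} {t : ℝ}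

/-- The slice of the moving cutoff is the annular ramp at the current radii (definitional). [folklore] -/
theorem movingCutoff_eq_annularRamp (x₀ : EuclideanSpace ℝ (Fin 3)) (k : ℝ) (ρ₁ ρ₂ : ℝ → ℝ) (t : ℝ) :
    movingCutoff x₀ k ρ₁ ρ₂ t = fun x => annularRamp k (ρ₁ t) (ρ₂ t) ‖x - x₀‖ := rfl

/-- The transition layers of `TaoLocalisedEnstrophy` at parameter `s` are the two layers
`{a < ‖x−x₀‖ < a + k⁻¹} ∪ {b − k⁻¹ < ‖x−x₀‖ < b}` of the ramp with radii `a = R₁' + s/c`,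
`b = R₂' − s/c` (the set over which the `Y₂`-term of the Y₆ estimate is taken). [folklore] -/
theorem transitionLayers_eq_setOf (x₀ : EuclideanSpace ℝ (Fin 3)) (k c R₁' R₂' s : ℝ) :
    transitionLayers x₀ k c R₁' R₂' s =
      {x | (R₁' + s / c < ‖x - x₀‖ ∧ ‖x - x₀‖ < R₁' + s / c + k⁻¹) ∨
        (R₂' - s / c - k⁻¹ < ‖x - x₀‖ ∧ ‖x - x₀‖ < R₂' - s / c)} := by
  ext x
  simp [transitionLayers]

/-- **The line derivative of the annular ramp**: away from the four kink spheres,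
`∂ᵥη(x) = κ(x) ‖x−x₀‖⁻¹ ⟨x − x₀, v⟩` with `κ = k` on the inner layer, `−k` on the outer layer and
`0` elsewhere; hence `|∂ᵥη(x)| ≤ k‖v‖` and `∂ᵥη = 0` off the layers. [cite: Tao2011, §10, proof of Thm. 10.1 ((10.12)–(10.13))] -/
theorem abs_lineDeriv_annularRamp_le {k a b : ℝ} (hk : 0 < k) (ha : 0 < a) (hgap : a + k⁻¹ < b - k⁻¹)
    {x₀ x : EuclideanSpace ℝ (Fin 3)} (h1 : ‖x - x₀‖ ≠ a) (h2 : ‖x - x₀‖ ≠ a + k⁻¹)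
    (h3 : ‖x - x₀‖ ≠ b - k⁻¹) (h4 : ‖x - x₀‖ ≠ b) (v : EuclideanSpace ℝ (Fin 3)) :
    |lineDeriv ℝ (fun y : EuclideanSpace ℝ (Fin 3) => annularRamp k a b ‖y - x₀‖) x v| ≤
      (if (a < ‖x - x₀‖ ∧ ‖x - x₀‖ < a + k⁻¹) ∨ (b - k⁻¹ < ‖x - x₀‖ ∧ ‖x - x₀‖ < b) then k else 0) *
        ‖v‖ := by
  have hD := hasFDerivAt_annularRamp_norm hk ha hgap h1 h2 h3 h4
  rw [(hD.hasLineDerivAt v).lineDeriv]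
  simp only [FunLike.coe_smul, Pi.smul_apply, innerSL_apply_apply, smul_eq_mul]
  have hcs : |‖x - x₀‖⁻¹ * ⟪x - x₀, v⟫| ≤ ‖v‖ := by
    rw [abs_mul, abs_inv, abs_norm]
    by_cases hx : ‖x - x₀‖ = 0
    · rw [hx, inv_zero, zero_mul]; exact norm_nonneg _
    · calc ‖x - x₀‖⁻¹ * |⟪x - x₀, v⟫| ≤ ‖x - x₀‖⁻¹ * (‖x - x₀‖ * ‖v‖) :=
            mul_le_mul_of_nonneg_left (abs_real_inner_le_norm _ _) (inv_nonneg.2 (norm_nonneg _))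
        _ = ‖v‖ := by field_simp
  by_cases hin : a < ‖x - x₀‖ ∧ ‖x - x₀‖ < a + k⁻¹
  · rw [if_pos hin, if_pos (Or.inl hin), abs_mul, abs_of_pos hk]
    exact mul_le_mul_of_nonneg_left hcs hk.le
  · rw [if_neg hin]
    by_cases hout : b - k⁻¹ < ‖x - x₀‖ ∧ ‖x - x₀‖ < b
    · rw [if_pos hout, if_pos (Or.inr hout), abs_mul, abs_neg, abs_of_pos hk]
      exact mul_le_mul_of_nonneg_left hcs hk.le
    · rw [if_neg hout, zero_mul, abs_zero, if_neg (not_or.2 ⟨hin, hout⟩), zero_mul]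

/-- From the finite-energy hypothesis in `ℝ≥0∞` form to the real form consumed by the Y₆
estimate: for a continuous slice, `∫⁻ ‖v‖ₑ² ≤ ofReal (2E)` gives `∫ ‖v‖² ≤ 2E` and integrability of
`‖v‖²`. [folklore] -/
theorem integral_norm_sq_le_of_lintegral_le {v : EuclideanSpace ℝ (Fin 3) → EuclideanSpace ℝ (Fin 3)}
    (hv : Continuous v) {E : ℝ} (hE : 0 ≤ E)
    (h : ∫⁻ x, ‖v x‖ₑ ^ 2 ≤ ENNReal.ofReal (2 * E)) :
    Integrable (fun x => ‖v x‖ ^ 2) ∧ (∫ x, ‖v x‖ ^ 2) ≤ 2 * E := by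
  have heq : ∀ x, ‖(‖v x‖ ^ 2)‖ₑ = ‖v x‖ₑ ^ 2 := fun x => by
    rw [Real.enorm_eq_ofReal (sq_nonneg _), ← ofReal_norm, ENNReal.ofReal_pow (norm_nonneg _)]
  have hint : Integrable (fun x => ‖v x‖ ^ 2) := by
    refine ⟨(hv.norm.pow 2).aestronglyMeasurable, ?_⟩
    rw [hasFiniteIntegral_iff_enorm]
    simp_rw [heq]
    exact h.trans_lt ENNReal.ofReal_lt_top
  refine ⟨hint, ?_⟩
  have h2 : ENNReal.ofReal (∫ x, ‖v x‖ ^ 2) ≤ ENNReal.ofReal (2 * E) := by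
    rw [ofReal_integral_eq_lintegral_ofReal hint (ae_of_all _ fun x => sq_nonneg _)]
    refine le_trans (lintegral_mono fun x => ?_) h
    rw [← ofReal_norm, ENNReal.ofReal_pow (norm_nonneg _)]
  exact (ENNReal.ofReal_le_ofReal_iff (by positivity)).1 h2

end Dictionary

section Static

variable {T : ℝ} {u : ℝ → EuclideanSpace ℝ (Fin 3) → EuclideanSpace ℝ (Fin 3)}
  {p : ℝ → EuclideanSpace ℝ (Fin 3) → ℝ}

/-- The two transition layers `{a < ‖x−x₀‖ < a + k⁻¹} ∪ {b − k⁻¹ < ‖x−x₀‖ < b}` form a bounded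
measurable set. [folklore] -/
theorem measurableSet_layers (x₀ : EuclideanSpace ℝ (Fin 3)) (k a b : ℝ) :
    MeasurableSet {x : EuclideanSpace ℝ (Fin 3) | (a < ‖x - x₀‖ ∧ ‖x - x₀‖ < a + k⁻¹) ∨
      (b - k⁻¹ < ‖x - x₀‖ ∧ ‖x - x₀‖ < b)} := by
  have hn : Continuous fun x : EuclideanSpace ℝ (Fin 3) => ‖x - x₀‖ := by fun_prop
  exact (((isOpen_lt continuous_const hn).inter (isOpen_lt hn continuous_const)).union
    ((isOpen_lt continuous_const hn).inter (isOpen_lt hn continuous_const))).measurableSet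

/-- **The transport term is paid by the recession term** (Tao 2011, (10.13)–(10.14):
"`∫|ω|²|∇η| ≲ c‖u‖_{L^∞}Y₂`", "`|Y₄| ≲ cY₂`"): for the annular ramp of slope `k`, a continuous
`ζ` and a field `U` with `|U| ≤ s` pointwise,
`∫ |ζ|² ∂_U η ≤ k s ∫_{layers} |ζ|²`. [cite: Tao2011, §10, proof of Thm. 10.1 ((10.13)–(10.14))] -/
theorem integral_norm_sq_mul_lineDeriv_annularRamp_le
    {ζ U : EuclideanSpace ℝ (Fin 3) → EuclideanSpace ℝ (Fin 3)} (hζ : Continuous ζ)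
    {k a b s : ℝ} (hk : 0 < k) (ha : 0 < a) (hgap : a + k⁻¹ < b - k⁻¹) (hs : ∀ x, ‖U x‖ ≤ s)
    (x₀ : EuclideanSpace ℝ (Fin 3)) :
    ∫ x, ‖ζ x‖ ^ 2 * lineDeriv ℝ (fun y : EuclideanSpace ℝ (Fin 3) => annularRamp k a b ‖y - x₀‖) x (U x) ≤
      k * s * ∫ x in {x : EuclideanSpace ℝ (Fin 3) | (a < ‖x - x₀‖ ∧ ‖x - x₀‖ < a + k⁻¹) ∨
        (b - k⁻¹ < ‖x - x₀‖ ∧ ‖x - x₀‖ < b)}, ‖ζ x‖ ^ 2 := by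
  set L : Set (EuclideanSpace ℝ (Fin 3)) := {x | (a < ‖x - x₀‖ ∧ ‖x - x₀‖ < a + k⁻¹) ∨
    (b - k⁻¹ < ‖x - x₀‖ ∧ ‖x - x₀‖ < b)} with hLdef
  have hL : MeasurableSet L := measurableSet_layers x₀ k a b
  have hs0 : 0 ≤ s := (norm_nonneg _).trans (hs x₀)
  have hc2 : Continuous fun x => ‖ζ x‖ ^ 2 := hζ.norm.pow 2
  -- the dominating function `k s 1_L |ζ|²`
  have hLb : L ⊆ Metric.closedBall x₀ b := fun x hx => by
    rw [Metric.mem_closedBall, dist_eq_norm]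
    rcases hx with h | h
    · have : (0 : ℝ) < k⁻¹ := inv_pos.2 hk
      linarith [h.2]
    · exact h.2.le
  have hintL : IntegrableOn (fun x => ‖ζ x‖ ^ 2) L volume :=
    (hc2.continuousOn.integrableOn_compact (isCompact_closedBall x₀ b)).mono_set hLb
  have hg : Integrable (L.indicator fun x => k * s * ‖ζ x‖ ^ 2) :=
    (integrable_indicator_iff hL).2 (hintL.const_mul (k * s))
  have hRHS : ∫ x, L.indicator (fun x => k * s * ‖ζ x‖ ^ 2) x = k * s * ∫ x in L, ‖ζ x‖ ^ 2 := by
    rw [MeasureTheory.integral_indicator hL, MeasureTheory.integral_const_mul]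
  rw [← hRHS]
  by_cases hint : Integrable fun x => ‖ζ x‖ ^ 2 *
      lineDeriv ℝ (fun y : EuclideanSpace ℝ (Fin 3) => annularRamp k a b ‖y - x₀‖) x (U x)
  · refine integral_mono_ae hint hg ?_
    filter_upwards [ae_norm_sub_ne x₀ a, ae_norm_sub_ne x₀ (a + k⁻¹), ae_norm_sub_ne x₀ (b - k⁻¹),
      ae_norm_sub_ne x₀ b] with x h1 h2 h3 h4
    have hld := abs_lineDeriv_annularRamp_le hk ha hgap h1 h2 h3 h4 (U x)
    have hle : ‖ζ x‖ ^ 2 * lineDeriv ℝ (fun y : EuclideanSpace ℝ (Fin 3) => annularRamp k a b ‖y - x₀‖) x (U x) ≤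
        ‖ζ x‖ ^ 2 * ((if (a < ‖x - x₀‖ ∧ ‖x - x₀‖ < a + k⁻¹) ∨ (b - k⁻¹ < ‖x - x₀‖ ∧ ‖x - x₀‖ < b)
          then k else 0) * ‖U x‖) :=
      mul_le_mul_of_nonneg_left ((le_abs_self _).trans hld) (sq_nonneg _)
    refine hle.trans ?_
    by_cases hx : x ∈ L
    · rw [indicator_of_mem hx, if_pos (by simpa [hLdef] using hx)]
      have : ‖ζ x‖ ^ 2 * (k * ‖U x‖) ≤ ‖ζ x‖ ^ 2 * (k * s) :=
        mul_le_mul_of_nonneg_left (mul_le_mul_of_nonneg_left (hs x) hk.le) (sq_nonneg _)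
      linarith
    · rw [indicator_of_notMem hx, if_neg (by simpa [hLdef] using hx), zero_mul, mul_zero]
  · rw [integral_undef hint]
    exact integral_nonneg fun x => by
      by_cases hx : x ∈ L
      · rw [indicator_of_mem hx]; positivity
      · rw [indicator_of_notMem hx]; exact le_rfl

end Static

section StaticRate

variable {T : ℝ} {u : ℝ → EuclideanSpace ℝ (Fin 3) → EuclideanSpace ℝ (Fin 3)}
  {p : ℝ → EuclideanSpace ℝ (Fin 3) → ℝ}

/-- **The enstrophy inequality at a fixed time** (Tao 2011, proof of Thm. 10.1, "collecting the
bounds for `Y₁, …, Y₆`", annular form): for a classical `ν = 1`, `f = 0` solution on the closed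
slab, a time `τ`, the annular ramp `η` of slope `k = c^{-1/10}δ²` with radii
`0 < R₁' ≤ a`, `a + 2k⁻¹ < b ≤ R₂'`, a speed bound `|u(τ)| ≤ s` and the energy bound
`∫|u(τ)|² ≤ 2E`, the production minus the recession term is at most
`−Y₁ + K(c^{1/20}δ⁻¹W^{1/2}Y₁ + c^{-3/20}δ³W^{3/2} + c^{3/4}W/T + 0 + b)`, where
`b = (k/2)(a²S(a) + b²S(b)) + (k/R₁')∫_{R₁'<‖x−x₀‖<R₂'}|ω|²` majorises the heat flux: the identity
(10.11) (`integral_enstrophyProduction_mul_weight`), `Y₃ ≤ b` (`heatFlux_le`,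
`mul_setIntegral_layer_inv_norm_le`), `|Y₄| ≤ cY₂`
(`integral_norm_sq_mul_lineDeriv_annularRamp_le`), the vendored nonlinear estimate for `Y₆`
(`tao2011_nonlinearEstimateWith K`), and the absorption `c + Kc^{9/10} ≤ 1` of `Y₄` and of the
`Y₂`-part of the `Y₆` bound into the recession term `−Y₂`. [cite: Tao2011, §10, proof of Thm. 10.1 ((10.11)–(10.14), (10.19)–(10.23))] -/
theorem enstrophyProduction_sub_recession_le (hT : 0 < T)
    (hsol : FluidPDE.IsClassicalNSSolutionOn (Icc 0 T) 1 0 u p)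
    {K c δ E k : ℝ} (hK : 1 ≤ K) (hc : 0 < c) (hc1 : c ≤ 1) (hδ : 0 < δ) (hE : 0 ≤ E)
    (hk : k = c ^ (-(1 / 10 : ℝ)) * δ ^ 2) (habs : c + K * c ^ (9 / 10 : ℝ) ≤ 1)
    (hY : tao2011_nonlinearEstimateWith K) (hsmall : δ ^ 5 * Real.sqrt E * T ≤ c)
    {τ : ℝ} (hτ : τ ∈ Icc 0 T) (hEτ : ∫⁻ x, ‖u τ x‖ₑ ^ 2 ≤ ENNReal.ofReal (2 * E))
    {s : ℝ} (hs : ∀ x, ‖u τ x‖ ≤ s) (x₀ : EuclideanSpace ℝ (Fin 3)) {R₁' R₂' a b : ℝ}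
    (hR₁ : 0 < R₁') (ha : R₁' ≤ a) (hab : a + 2 * k⁻¹ < b) (hb : b ≤ R₂') :
    (∫ x, enstrophyProduction T u τ x * annularRamp k a b ‖x - x₀‖) -
        k / c * s * (1 / 2 * ∫ x in {x : EuclideanSpace ℝ (Fin 3) |
          (a < ‖x - x₀‖ ∧ ‖x - x₀‖ < a + k⁻¹) ∨ (b - k⁻¹ < ‖x - x₀‖ ∧ ‖x - x₀‖ < b)},
            ‖FluidPDE.curl (u τ) x‖ ^ 2) ≤
      -localisedEnstrophyDissipation (fun x => annularRamp k a b ‖x - x₀‖) (u τ) +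
        K * (c ^ (1 / 20 : ℝ) * δ⁻¹ *
              Real.sqrt (localisedEnstrophy (fun x => annularRamp k a b ‖x - x₀‖) (u τ)) *
              localisedEnstrophyDissipation (fun x => annularRamp k a b ‖x - x₀‖) (u τ) +
            c ^ (-(3 / 20 : ℝ)) * δ ^ 3 *
              (localisedEnstrophy (fun x => annularRamp k a b ‖x - x₀‖) (u τ) *
                Real.sqrt (localisedEnstrophy (fun x => annularRamp k a b ‖x - x₀‖) (u τ))) +
            c ^ (3 / 4 : ℝ) * localisedEnstrophy (fun x => annularRamp k a b ‖x - x₀‖) (u τ) / T +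
            0 * Real.sqrt (localisedEnstrophy (fun x => annularRamp k a b ‖x - x₀‖) (u τ)) +
            (k / 2 * (a ^ 2 * sphereNormSq (FluidPDE.curl (u τ)) x₀ a +
                b ^ 2 * sphereNormSq (FluidPDE.curl (u τ)) x₀ b) +
              k / R₁' * ∫ x in {x : EuclideanSpace ℝ (Fin 3) | R₁' < ‖x - x₀‖ ∧ ‖x - x₀‖ < R₂'},
                ‖FluidPDE.curl (u τ) x‖ ^ 2)) := by
  -- positivity of the slope and the geometry of the radii
  have hk0 : 0 < k := by rw [hk]; positivity
  have hki : 0 < k⁻¹ := inv_pos.2 hk0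
  have ha0 : 0 < a := hR₁.trans_le ha
  have hab' : a + k⁻¹ < b - k⁻¹ := by linarith
  have hbR : a + k⁻¹ ≤ R₂' := by linarith
  -- regularity of the slice
  have hu : ContDiff ℝ ∞ (u τ) := hsol.contDiff_velocity hτ
  have hζ1 : ContDiff ℝ 1 (FluidPDE.curl (u τ)) := FluidPDE.contDiff_curl (n := 1) (hu.of_le (by norm_cast))
  have hζc : Continuous (FluidPDE.curl (u τ)) := hζ1.continuous
  obtain ⟨hL2i, hL2⟩ := integral_norm_sq_le_of_lintegral_le (hu.continuous) hE hEτ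
  have hs0 : 0 ≤ s := (norm_nonneg _).trans (hs x₀)
  -- the weight (through the moving-cutoff API with frozen radii)
  set η : EuclideanSpace ℝ (Fin 3) → ℝ := fun x => annularRamp k a b ‖x - x₀‖ with hηdef
  have hlip : LipschitzWith (Real.toNNReal k) η :=
    lipschitzWith_movingCutoff hk0.le x₀ (fun _ => a) (fun _ => b) 0
  have hηc : HasCompactSupport η := hasCompactSupport_movingCutoff (ρ₁ := fun _ => a)
    (ρ₂ := fun _ => b) (t := 0) hk0.le
  have hη0 : ∀ x, 0 ≤ η x := fun x => annularRamp_nonneg _ _ _ _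
  -- (10.11): the identity, with `f = 0`
  have hid := integral_enstrophyProduction_mul_weight hT hsol hτ hlip hηc
  have hf0 : (∫ x, ⟪FluidPDE.curl (u τ) x, FluidPDE.curl ((0 : ℝ → EuclideanSpace ℝ (Fin 3) →
      EuclideanSpace ℝ (Fin 3)) τ) x⟫ * η x) = 0 := by
    simp [FluidPDE.curl_zero]
  rw [hf0, add_zero, one_mul, one_mul] at hid
  have hY₁eq : localisedEnstrophyDissipation η (u τ) =
      ∫ x, FluidPDE.frobeniusNormSq (fderiv ℝ (FluidPDE.curl (u τ)) x) * η x := rfl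
  rw [← hY₁eq] at hid
  -- Y₃ ≤ heat-flux majorant
  have hY3 := heatFlux_le (ζ := FluidPDE.curl (u τ)) (x₀ := x₀) hζ1 zero_le_one hk0 ha0 hab'
  rw [one_mul, one_mul, ← hηdef] at hY3
  have hcurv := mul_setIntegral_layer_inv_norm_le hζc x₀ (ℓ := k⁻¹) hk0.le hR₁ ha hbR
  -- |Y₄| ≤ c Y₂
  have hY4 := integral_norm_sq_mul_lineDeriv_annularRamp_le (U := u τ) hζc hk0 ha0 hab' hs x₀
  rw [← hηdef] at hY4
  -- the nonlinear estimate for Y₆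
  have hab_k : a + 2 * (c ^ (-(1 / 10 : ℝ)) * δ ^ 2)⁻¹ < b := by rw [← hk]; exact hab
  have hY6 := hY hc hc1 hδ hT hE hsmall hu (hsol.divFree τ hτ) hL2 hL2i hs x₀ ha0 hab_k
  rw [← hk] at hY6
  rw [← hηdef] at hY6
  have hY6' := (le_abs_self _).trans hY6
  -- name the atoms
  set W : ℝ := localisedEnstrophy η (u τ) with hWdef
  set Y₁ : ℝ := localisedEnstrophyDissipation η (u τ) with hY₁def
  set IL : ℝ := ∫ x in {x : EuclideanSpace ℝ (Fin 3) |
      (a < ‖x - x₀‖ ∧ ‖x - x₀‖ < a + k⁻¹) ∨ (b - k⁻¹ < ‖x - x₀‖ ∧ ‖x - x₀‖ < b)},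
        ‖FluidPDE.curl (u τ) x‖ ^ 2 with hILdef
  set IS : ℝ := ∫ x in {x : EuclideanSpace ℝ (Fin 3) | R₁' < ‖x - x₀‖ ∧ ‖x - x₀‖ < R₂'},
      ‖FluidPDE.curl (u τ) x‖ ^ 2 with hISdef
  set Sa : ℝ := sphereNormSq (FluidPDE.curl (u τ)) x₀ a with hSadef
  set Sb : ℝ := sphereNormSq (FluidPDE.curl (u τ)) x₀ b with hSbdef
  have hW0 : 0 ≤ W := localisedEnstrophy_nonneg hη0 _
  have hY₁0 : 0 ≤ Y₁ := localisedEnstrophyDissipation_nonneg hη0 _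
  have hIL0 : 0 ≤ IL := setIntegral_nonneg (measurableSet_layers x₀ k a b) fun x _ => sq_nonneg _
  have hIS0 : 0 ≤ IS := by
    have hn : Continuous fun x : EuclideanSpace ℝ (Fin 3) => ‖x - x₀‖ := by fun_prop
    exact setIntegral_nonneg ((isOpen_lt continuous_const hn).measurableSet.inter
      (isOpen_lt hn continuous_const).measurableSet) fun x _ => sq_nonneg _
  have hSa : 0 ≤ Sa := sphereNormSq_nonneg (FluidPDE.curl (u τ)) x₀ a
  have hSb : 0 ≤ Sb := sphereNormSq_nonneg (FluidPDE.curl (u τ)) x₀ b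
  -- absorption of the layer terms into the recession term
  have hlayer : 1 / 2 * (k * s * IL) + K * c ^ (9 / 10 : ℝ) * (k / (2 * c) * s * IL) -
      k / c * s * (1 / 2 * IL) = (s * k * IL) / (2 * c) * (c + K * c ^ (9 / 10 : ℝ) - 1) := by
    field_simp
  have hIL_comb : 1 / 2 * (k * s * IL) + K * c ^ (9 / 10 : ℝ) * (k / (2 * c) * s * IL) -
      k / c * s * (1 / 2 * IL) ≤ 0 := by
    rw [hlayer]
    exact mul_nonpos_of_nonneg_of_nonpos (by positivity) (by linarith)
  -- the heat-flux majorant is nonnegative and `K ≥ 1`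
  have hbflux0 : 0 ≤ k / 2 * (a ^ 2 * Sa + b ^ 2 * Sb) + k / R₁' * IS := by positivity
  have hbflux : k / 2 * (a ^ 2 * Sa + b ^ 2 * Sb) + k / R₁' * IS ≤
      K * (k / 2 * (a ^ 2 * Sa + b ^ 2 * Sb) + k / R₁' * IS) :=
    le_mul_of_one_le_left hbflux0 hK
  -- bookkeeping identities aligning the two parenthesisations
  have e1 : K * (c ^ (1 / 20 : ℝ) * δ⁻¹ * Real.sqrt W * Y₁ +
        c ^ (-(3 / 20 : ℝ)) * δ ^ 3 * (W * Real.sqrt W) + c ^ (3 / 4 : ℝ) * W / T +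
        0 * Real.sqrt W + (k / 2 * (a ^ 2 * Sa + b ^ 2 * Sb) + k / R₁' * IS)) =
      K * (c ^ (1 / 20 : ℝ) * δ⁻¹ * (Real.sqrt W * Y₁)) +
        K * (c ^ (-(3 / 20 : ℝ)) * δ ^ 3 * (W * Real.sqrt W)) + K * (c ^ (3 / 4 : ℝ) * W / T) +
        K * (k / 2 * (a ^ 2 * Sa + b ^ 2 * Sb) + k / R₁' * IS) := by ring
  have e2 : K * (c ^ (-(3 / 20 : ℝ)) * δ ^ 3 * (W * Real.sqrt W) +
        c ^ (1 / 20 : ℝ) * δ⁻¹ * (Real.sqrt W * Y₁) + c ^ (3 / 4 : ℝ) * W / T) +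
        K * c ^ (9 / 10 : ℝ) * (k / (2 * c) * s * IL) =
      K * (c ^ (1 / 20 : ℝ) * δ⁻¹ * (Real.sqrt W * Y₁)) +
        K * (c ^ (-(3 / 20 : ℝ)) * δ ^ 3 * (W * Real.sqrt W)) + K * (c ^ (3 / 4 : ℝ) * W / T) +
        K * c ^ (9 / 10 : ℝ) * (k / (2 * c) * s * IL) := by ring
  rw [hid]
  linarith [hY3, hcurv, hY4, hY6', hIL_comb, hbflux, e1, e2]

end StaticRate

section Integrated

variable {T : ℝ} {u : ℝ → EuclideanSpace ℝ (Fin 3) → EuclideanSpace ℝ (Fin 3)}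
  {p : ℝ → EuclideanSpace ℝ (Fin 3) → ℝ}

/-- Continuity on `[0, T]` of the two speed-driven radii `R₁' + σ(t)/c`, `R₂' − σ(t)/c`. [folklore] -/
theorem continuousOn_speedRadii (hT : 0 < T) (hu : FluidPDE.IsSmoothSpaceTimeOn (Icc 0 T) u) {M : ℝ}
    (hMt : ∫⁻ t in Ioo 0 T, eLpNorm (u t) ∞ volume ≤ ENNReal.ofReal M) (c R₁' R₂' : ℝ) :
    ContinuousOn (fun t => R₁' + speedIntegral u t / c) (Icc 0 T) ∧
      ContinuousOn (fun t => R₂' - speedIntegral u t / c) (Icc 0 T) :=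
  ⟨continuousOn_const.add ((continuousOn_speedIntegral hT hu hMt).div_const c),
    continuousOn_const.sub ((continuousOn_speedIntegral hT hu hMt).div_const c)⟩

/-- **Continuity of the heat-flux majorant** `b(t) = (k/2)(ρ₁²S(ρ₁) + ρ₂²S(ρ₂)) +
(k/R₁')∫_{R₁'<‖x−x₀‖<R₂'}|ω(t)|²` along the speed-driven radii, on `[0, T]` (`0 ≤ R₁'`). [cite: Tao2011, §10, proof of Thm. 10.1 (the quantity b(t))] -/
theorem continuousOn_heatFluxMajorant (hT : 0 < T)
    (hsol : FluidPDE.IsClassicalNSSolutionOn (Icc 0 T) 1 0 u p) {M : ℝ}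
    (hMt : ∫⁻ t in Ioo 0 T, eLpNorm (u t) ∞ volume ≤ ENNReal.ofReal M) (x₀ : EuclideanSpace ℝ (Fin 3))
    {k c R₁' R₂' : ℝ} (hR₁ : 0 ≤ R₁') :
    ContinuousOn (fun t => k / 2 * ((R₁' + speedIntegral u t / c) ^ 2 *
        sphereNormSq (FluidPDE.curl (u t)) x₀ (R₁' + speedIntegral u t / c) +
        (R₂' - speedIntegral u t / c) ^ 2 *
          sphereNormSq (FluidPDE.curl (u t)) x₀ (R₂' - speedIntegral u t / c)) +
      k / R₁' * ∫ x in {x : EuclideanSpace ℝ (Fin 3) | R₁' < ‖x - x₀‖ ∧ ‖x - x₀‖ < R₂'},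
        ‖FluidPDE.curl (u t) x‖ ^ 2) (Icc 0 T) := by
  obtain ⟨h₁, h₂⟩ := continuousOn_speedRadii hT hsol.smooth_velocity hMt c R₁' R₂'
  have hs₁ := continuousOn_sq_mul_sphereNormSq_curl hT hsol.smooth_velocity x₀ h₁
  have hs₂ := continuousOn_sq_mul_sphereNormSq_curl hT hsol.smooth_velocity x₀ h₂
  have hsh := continuousOn_setIntegral_shell_curl_sq hT hsol.smooth_velocity x₀ (b := R₂') hR₁
  exact (continuousOn_const.mul (hs₁.add hs₂)).add (continuousOn_const.mul hsh)

/-- **Tao 2011, proof of Thm. 10.1: the integrated enstrophy inequality** (annular form,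
unit viscosity, `f = 0`). Along the moving cutoff `η(t) = annularRamp k (R₁' + σ(t)/c)
(R₂' − σ(t)/c) ‖· − x₀‖` with `σ(t) = ∫₀ᵗ‖u‖_{L^∞}`, `k = c^{-1/10}δ²`, for a classical solution
with `sup_t ∫|u|² ≤ 2E`, `∫₀ᵀ‖u‖_{L^∞} ≤ M` and the gap `R₁' + M/c + 2k⁻¹ < R₂' − M/c`, and under
the smallness `δ⁵E^{1/2}T ≤ c` and the absorption condition `c + Kc^{9/10} ≤ 1`: for `t ∈ [0,T]`,
`W(t) + ∫₀ᵗ Y₁ ≤ W(0) + ∫₀ᵗ K(c^{1/20}δ⁻¹W^{1/2}Y₁ + c^{-3/20}δ³W^{3/2} + c^{3/4}W/T + 0·W^{1/2} + b)`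
with `b` the heat-flux majorant — the integrated form of
"`∂ₜW ≤ −Y₁ + O(c^{0.05}δ⁻¹W^{1/2}Y₁ + c^{-0.15}δ³W^{3/2} + c^{0.75}W/T + a(t)W^{1/2} + b(t))`"
(p. 33; `a = 0` without forcing), obtained from the kinematic identity
`NS.localisedEnstrophy_movingCutoff_sub_eq` and the fixed-time inequality
`enstrophyProduction_sub_recession_le` at almost every time. [cite: Tao2011, §10, proof of Thm. 10.1 ((10.11)–(10.23))] -/
theorem localisedEnstrophy_add_intervalIntegral_le (hT : 0 < T)
    (hsol : FluidPDE.IsClassicalNSSolutionOn (Icc 0 T) 1 0 u p)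
    {K c δ E M k : ℝ} (hK : 1 ≤ K) (hc : 0 < c) (hc1 : c ≤ 1) (hδ : 0 < δ) (hE : 0 ≤ E)
    (hM : 0 ≤ M) (hk : k = c ^ (-(1 / 10 : ℝ)) * δ ^ 2) (habs : c + K * c ^ (9 / 10 : ℝ) ≤ 1)
    (hY : tao2011_nonlinearEstimateWith K) (hsmall : δ ^ 5 * Real.sqrt E * T ≤ c)
    (hEt : ∀ t ∈ Icc 0 T, ∫⁻ x, ‖u t x‖ₑ ^ 2 ≤ ENNReal.ofReal (2 * E))
    (hMt : ∫⁻ t in Ioo 0 T, eLpNorm (u t) ∞ volume ≤ ENNReal.ofReal M)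
    (x₀ : EuclideanSpace ℝ (Fin 3)) {R₁' R₂' : ℝ} (hR₁ : 0 < R₁')
    (hgap : R₁' + M / c + 2 * k⁻¹ < R₂' - M / c) {t : ℝ} (ht : t ∈ Icc 0 T) :
    localisedEnstrophy (movingCutoff x₀ k (fun t => R₁' + speedIntegral u t / c)
        (fun t => R₂' - speedIntegral u t / c) t) (u t) +
      ∫ s in (0)..t, localisedEnstrophyDissipation (movingCutoff x₀ k
        (fun t => R₁' + speedIntegral u t / c) (fun t => R₂' - speedIntegral u t / c) s) (u s) ≤
    localisedEnstrophy (movingCutoff x₀ k (fun t => R₁' + speedIntegral u t / c)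
        (fun t => R₂' - speedIntegral u t / c) 0) (u 0) +
      ∫ s in (0)..t, K * (c ^ (1 / 20 : ℝ) * δ⁻¹ *
          Real.sqrt (localisedEnstrophy (movingCutoff x₀ k (fun t => R₁' + speedIntegral u t / c)
            (fun t => R₂' - speedIntegral u t / c) s) (u s)) *
          localisedEnstrophyDissipation (movingCutoff x₀ k (fun t => R₁' + speedIntegral u t / c)
            (fun t => R₂' - speedIntegral u t / c) s) (u s) +
        c ^ (-(3 / 20 : ℝ)) * δ ^ 3 *
          (localisedEnstrophy (movingCutoff x₀ k (fun t => R₁' + speedIntegral u t / c)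
              (fun t => R₂' - speedIntegral u t / c) s) (u s) *
            Real.sqrt (localisedEnstrophy (movingCutoff x₀ k (fun t => R₁' + speedIntegral u t / c)
              (fun t => R₂' - speedIntegral u t / c) s) (u s))) +
        c ^ (3 / 4 : ℝ) * localisedEnstrophy (movingCutoff x₀ k (fun t => R₁' + speedIntegral u t / c)
            (fun t => R₂' - speedIntegral u t / c) s) (u s) / T +
        0 * Real.sqrt (localisedEnstrophy (movingCutoff x₀ k (fun t => R₁' + speedIntegral u t / c)
            (fun t => R₂' - speedIntegral u t / c) s) (u s)) +
        (k / 2 * ((R₁' + speedIntegral u s / c) ^ 2 *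
            sphereNormSq (FluidPDE.curl (u s)) x₀ (R₁' + speedIntegral u s / c) +
            (R₂' - speedIntegral u s / c) ^ 2 *
              sphereNormSq (FluidPDE.curl (u s)) x₀ (R₂' - speedIntegral u s / c)) +
          k / R₁' * ∫ x in {x : EuclideanSpace ℝ (Fin 3) | R₁' < ‖x - x₀‖ ∧ ‖x - x₀‖ < R₂'},
            ‖FluidPDE.curl (u s) x‖ ^ 2)) := by
  have hk0 : 0 < k := by rw [hk]; positivity
  have hki : 0 < k⁻¹ := inv_pos.2 hk0
  have hu := hsol.smooth_velocity
  -- the speed integral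
  have hσac := absolutelyContinuousOnInterval_speedIntegral hT hu hMt
  have hσ0 : ∀ s ∈ Icc 0 T, 0 ≤ speedIntegral u s := fun s hs => speedIntegral_nonneg hT hu hMt hs
  have hσM : ∀ s ∈ Icc 0 T, speedIntegral u s ≤ M := fun s hs => speedIntegral_le_of_mem hT hM hu hMt hs
  have hσd := ae_hasDerivAt_speedIntegral hT hu hMt
  have hgap' : R₁' + M / c + k⁻¹ < R₂' - M / c - k⁻¹ := by linarith
  obtain ⟨hρ₁c, hρ₂c⟩ := continuousOn_speedRadii hT hu hMt c R₁' R₂'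
  have hρ₂le : ∀ s ∈ Icc 0 T, R₂' - speedIntegral u s / c ≤ R₂' := fun s hs => by
    have := div_nonneg (hσ0 s hs) hc.le; linarith
  -- continuity of W, Y₁ and b on [0, T]
  have hWc := continuousOn_localisedEnstrophy_movingCutoff (x₀ := x₀) hT hsol hk0.le hρ₁c hρ₂c hρ₂le
  have hYc := continuousOn_localisedEnstrophyDissipation_movingCutoff (x₀ := x₀) hT hsol hk0.le hρ₁c
    hρ₂c hρ₂le
  have hbc := continuousOn_heatFluxMajorant (k := k) (c := c) (R₂' := R₂') hT hsol hMt x₀ hR₁.le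
  -- the kinematic identity and integrability of the rate
  have hid := localisedEnstrophy_movingCutoff_sub_eq (x₀ := x₀) hT hu hk0 hc hσac hσ0 hσM hσd hgap'
    le_rfl ht.1 ht.2
  have hrate := intervalIntegrable_localisedEnstrophy_rate (x₀ := x₀) hT hu hk0 hc hσac hσ0 hσM hσd
    hgap' le_rfl ht.1 ht.2
  -- the fixed-time inequality, at almost every time of `[0, t]`
  have hgood : ∀ᵐ τ ∂(volume.restrict (Icc 0 t)), ∀ x, ‖u τ x‖ ≤ speed u τ := by
    have h1 := (ae_restrict_iff' measurableSet_Ioo).1 (ae_norm_le_speed hu hMt)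
    have h0 : ∀ᵐ τ : ℝ, τ ≠ 0 := by simp [ae_iff, measure_singleton]
    have hTne : ∀ᵐ τ : ℝ, τ ≠ T := by simp [ae_iff, measure_singleton]
    refine (ae_restrict_iff' measurableSet_Icc).2 ?_
    filter_upwards [h1, h0, hTne] with τ h1 h0 hTne hτ
    exact h1 ⟨lt_of_le_of_ne hτ.1 (Ne.symm h0), lt_of_le_of_ne (hτ.2.trans ht.2) hTne⟩
  have hpt : ∀ᵐ τ ∂(volume.restrict (Icc 0 t)),
      (∫ x, enstrophyProduction T u τ x * movingCutoff x₀ k (fun t => R₁' + speedIntegral u t / c)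
          (fun t => R₂' - speedIntegral u t / c) τ x) -
        k / c * speed u τ * (1 / 2 * ∫ x in transitionLayers x₀ k c R₁' R₂' (speedIntegral u τ),
          ‖FluidPDE.curl (u τ) x‖ ^ 2) ≤
      -localisedEnstrophyDissipation (movingCutoff x₀ k (fun t => R₁' + speedIntegral u t / c)
          (fun t => R₂' - speedIntegral u t / c) τ) (u τ) +
        K * (c ^ (1 / 20 : ℝ) * δ⁻¹ *
          Real.sqrt (localisedEnstrophy (movingCutoff x₀ k (fun t => R₁' + speedIntegral u t / c)
            (fun t => R₂' - speedIntegral u t / c) τ) (u τ)) *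
          localisedEnstrophyDissipation (movingCutoff x₀ k (fun t => R₁' + speedIntegral u t / c)
            (fun t => R₂' - speedIntegral u t / c) τ) (u τ) +
        c ^ (-(3 / 20 : ℝ)) * δ ^ 3 *
          (localisedEnstrophy (movingCutoff x₀ k (fun t => R₁' + speedIntegral u t / c)
              (fun t => R₂' - speedIntegral u t / c) τ) (u τ) *
            Real.sqrt (localisedEnstrophy (movingCutoff x₀ k (fun t => R₁' + speedIntegral u t / c)
              (fun t => R₂' - speedIntegral u t / c) τ) (u τ))) +
        c ^ (3 / 4 : ℝ) * localisedEnstrophy (movingCutoff x₀ k (fun t => R₁' + speedIntegral u t / c)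
            (fun t => R₂' - speedIntegral u t / c) τ) (u τ) / T +
        0 * Real.sqrt (localisedEnstrophy (movingCutoff x₀ k (fun t => R₁' + speedIntegral u t / c)
            (fun t => R₂' - speedIntegral u t / c) τ) (u τ)) +
        (k / 2 * ((R₁' + speedIntegral u τ / c) ^ 2 *
            sphereNormSq (FluidPDE.curl (u τ)) x₀ (R₁' + speedIntegral u τ / c) +
            (R₂' - speedIntegral u τ / c) ^ 2 *
              sphereNormSq (FluidPDE.curl (u τ)) x₀ (R₂' - speedIntegral u τ / c)) +
          k / R₁' * ∫ x in {x : EuclideanSpace ℝ (Fin 3) | R₁' < ‖x - x₀‖ ∧ ‖x - x₀‖ < R₂'},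
            ‖FluidPDE.curl (u τ) x‖ ^ 2)) := by
    filter_upwards [hgood, ae_restrict_mem measurableSet_Icc] with τ hτs hτt
    have hτ : τ ∈ Icc 0 T := ⟨hτt.1, hτt.2.trans ht.2⟩
    have ha : R₁' ≤ R₁' + speedIntegral u τ / c := by
      have := div_nonneg (hσ0 τ hτ) hc.le; linarith
    have hab : R₁' + speedIntegral u τ / c + 2 * k⁻¹ < R₂' - speedIntegral u τ / c := by
      have : speedIntegral u τ / c ≤ M / c := div_le_div_of_nonneg_right (hσM τ hτ) hc.le
      linarith
    have hst := enstrophyProduction_sub_recession_le hT hsol hK hc hc1 hδ hE hk habs hY hsmall hτ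
      (hEt τ hτ) hτs x₀ hR₁ ha hab (hρ₂le τ hτ)
    rw [transitionLayers_eq_setOf]
    exact hst
  -- integrate the fixed-time inequality over `[0, t]`
  have hG'i : IntervalIntegrable (fun τ => K * (c ^ (1 / 20 : ℝ) * δ⁻¹ *
          Real.sqrt (localisedEnstrophy (movingCutoff x₀ k (fun t => R₁' + speedIntegral u t / c)
            (fun t => R₂' - speedIntegral u t / c) τ) (u τ)) *
          localisedEnstrophyDissipation (movingCutoff x₀ k (fun t => R₁' + speedIntegral u t / c)
            (fun t => R₂' - speedIntegral u t / c) τ) (u τ) +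
        c ^ (-(3 / 20 : ℝ)) * δ ^ 3 *
          (localisedEnstrophy (movingCutoff x₀ k (fun t => R₁' + speedIntegral u t / c)
              (fun t => R₂' - speedIntegral u t / c) τ) (u τ) *
            Real.sqrt (localisedEnstrophy (movingCutoff x₀ k (fun t => R₁' + speedIntegral u t / c)
              (fun t => R₂' - speedIntegral u t / c) τ) (u τ))) +
        c ^ (3 / 4 : ℝ) * localisedEnstrophy (movingCutoff x₀ k (fun t => R₁' + speedIntegral u t / c)
            (fun t => R₂' - speedIntegral u t / c) τ) (u τ) / T +
        0 * Real.sqrt (localisedEnstrophy (movingCutoff x₀ k (fun t => R₁' + speedIntegral u t / c)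
            (fun t => R₂' - speedIntegral u t / c) τ) (u τ)) +
        (k / 2 * ((R₁' + speedIntegral u τ / c) ^ 2 *
            sphereNormSq (FluidPDE.curl (u τ)) x₀ (R₁' + speedIntegral u τ / c) +
            (R₂' - speedIntegral u τ / c) ^ 2 *
              sphereNormSq (FluidPDE.curl (u τ)) x₀ (R₂' - speedIntegral u τ / c)) +
          k / R₁' * ∫ x in {x : EuclideanSpace ℝ (Fin 3) | R₁' < ‖x - x₀‖ ∧ ‖x - x₀‖ < R₂'},
            ‖FluidPDE.curl (u τ) x‖ ^ 2))) volume 0 t := by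
    refine ((continuousOn_const.mul ?_).mono (Icc_subset_Icc le_rfl ht.2)).intervalIntegrable_of_Icc ht.1
    exact ((((((continuousOn_const.mul hWc.sqrt).mul hYc).add
      (continuousOn_const.mul (hWc.mul hWc.sqrt))).add ((continuousOn_const.mul hWc).div_const T)).add
      (continuousOn_const.mul hWc.sqrt)).add hbc)
  have hYi : IntervalIntegrable (fun τ => localisedEnstrophyDissipation (movingCutoff x₀ k
      (fun t => R₁' + speedIntegral u t / c) (fun t => R₂' - speedIntegral u t / c) τ) (u τ)) volume 0 t :=
    (hYc.mono (Icc_subset_Icc le_rfl ht.2)).intervalIntegrable_of_Icc ht.1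
  have hRi : IntervalIntegrable (fun τ => -localisedEnstrophyDissipation (movingCutoff x₀ k
      (fun t => R₁' + speedIntegral u t / c) (fun t => R₂' - speedIntegral u t / c) τ) (u τ) + K * (c ^ (1 / 20 : ℝ) * δ⁻¹ *
          Real.sqrt (localisedEnstrophy (movingCutoff x₀ k (fun t => R₁' + speedIntegral u t / c)
            (fun t => R₂' - speedIntegral u t / c) τ) (u τ)) *
          localisedEnstrophyDissipation (movingCutoff x₀ k (fun t => R₁' + speedIntegral u t / c)
            (fun t => R₂' - speedIntegral u t / c) τ) (u τ) +
        c ^ (-(3 / 20 : ℝ)) * δ ^ 3 *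
          (localisedEnstrophy (movingCutoff x₀ k (fun t => R₁' + speedIntegral u t / c)
              (fun t => R₂' - speedIntegral u t / c) τ) (u τ) *
            Real.sqrt (localisedEnstrophy (movingCutoff x₀ k (fun t => R₁' + speedIntegral u t / c)
              (fun t => R₂' - speedIntegral u t / c) τ) (u τ))) +
        c ^ (3 / 4 : ℝ) * localisedEnstrophy (movingCutoff x₀ k (fun t => R₁' + speedIntegral u t / c)
            (fun t => R₂' - speedIntegral u t / c) τ) (u τ) / T +
        0 * Real.sqrt (localisedEnstrophy (movingCutoff x₀ k (fun t => R₁' + speedIntegral u t / c)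
            (fun t => R₂' - speedIntegral u t / c) τ) (u τ)) +
        (k / 2 * ((R₁' + speedIntegral u τ / c) ^ 2 *
            sphereNormSq (FluidPDE.curl (u τ)) x₀ (R₁' + speedIntegral u τ / c) +
            (R₂' - speedIntegral u τ / c) ^ 2 *
              sphereNormSq (FluidPDE.curl (u τ)) x₀ (R₂' - speedIntegral u τ / c)) +
          k / R₁' * ∫ x in {x : EuclideanSpace ℝ (Fin 3) | R₁' < ‖x - x₀‖ ∧ ‖x - x₀‖ < R₂'},
            ‖FluidPDE.curl (u τ) x‖ ^ 2))) volume 0 t := hYi.neg.add hG'i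
  have hmono := intervalIntegral.integral_mono_ae_restrict ht.1 hrate hRi hpt
  have hsplit : (∫ τ in (0)..t, (-localisedEnstrophyDissipation (movingCutoff x₀ k
      (fun t => R₁' + speedIntegral u t / c) (fun t => R₂' - speedIntegral u t / c) τ) (u τ) + K * (c ^ (1 / 20 : ℝ) * δ⁻¹ *
          Real.sqrt (localisedEnstrophy (movingCutoff x₀ k (fun t => R₁' + speedIntegral u t / c)
            (fun t => R₂' - speedIntegral u t / c) τ) (u τ)) *
          localisedEnstrophyDissipation (movingCutoff x₀ k (fun t => R₁' + speedIntegral u t / c)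
            (fun t => R₂' - speedIntegral u t / c) τ) (u τ) +
        c ^ (-(3 / 20 : ℝ)) * δ ^ 3 *
          (localisedEnstrophy (movingCutoff x₀ k (fun t => R₁' + speedIntegral u t / c)
              (fun t => R₂' - speedIntegral u t / c) τ) (u τ) *
            Real.sqrt (localisedEnstrophy (movingCutoff x₀ k (fun t => R₁' + speedIntegral u t / c)
              (fun t => R₂' - speedIntegral u t / c) τ) (u τ))) +
        c ^ (3 / 4 : ℝ) * localisedEnstrophy (movingCutoff x₀ k (fun t => R₁' + speedIntegral u t / c)
            (fun t => R₂' - speedIntegral u t / c) τ) (u τ) / T +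
        0 * Real.sqrt (localisedEnstrophy (movingCutoff x₀ k (fun t => R₁' + speedIntegral u t / c)
            (fun t => R₂' - speedIntegral u t / c) τ) (u τ)) +
        (k / 2 * ((R₁' + speedIntegral u τ / c) ^ 2 *
            sphereNormSq (FluidPDE.curl (u τ)) x₀ (R₁' + speedIntegral u τ / c) +
            (R₂' - speedIntegral u τ / c) ^ 2 *
              sphereNormSq (FluidPDE.curl (u τ)) x₀ (R₂' - speedIntegral u τ / c)) +
          k / R₁' * ∫ x in {x : EuclideanSpace ℝ (Fin 3) | R₁' < ‖x - x₀‖ ∧ ‖x - x₀‖ < R₂'},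
            ‖FluidPDE.curl (u τ) x‖ ^ 2)))) = -(∫ τ in (0)..t, localisedEnstrophyDissipation (movingCutoff x₀ k
      (fun t => R₁' + speedIntegral u t / c) (fun t => R₂' - speedIntegral u t / c) τ) (u τ)) + ∫ τ in (0)..t, K * (c ^ (1 / 20 : ℝ) * δ⁻¹ *
          Real.sqrt (localisedEnstrophy (movingCutoff x₀ k (fun t => R₁' + speedIntegral u t / c)
            (fun t => R₂' - speedIntegral u t / c) τ) (u τ)) *
          localisedEnstrophyDissipation (movingCutoff x₀ k (fun t => R₁' + speedIntegral u t / c)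
            (fun t => R₂' - speedIntegral u t / c) τ) (u τ) +
        c ^ (-(3 / 20 : ℝ)) * δ ^ 3 *
          (localisedEnstrophy (movingCutoff x₀ k (fun t => R₁' + speedIntegral u t / c)
              (fun t => R₂' - speedIntegral u t / c) τ) (u τ) *
            Real.sqrt (localisedEnstrophy (movingCutoff x₀ k (fun t => R₁' + speedIntegral u t / c)
              (fun t => R₂' - speedIntegral u t / c) τ) (u τ))) +
        c ^ (3 / 4 : ℝ) * localisedEnstrophy (movingCutoff x₀ k (fun t => R₁' + speedIntegral u t / c)
            (fun t => R₂' - speedIntegral u t / c) τ) (u τ) / T +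
        0 * Real.sqrt (localisedEnstrophy (movingCutoff x₀ k (fun t => R₁' + speedIntegral u t / c)
            (fun t => R₂' - speedIntegral u t / c) τ) (u τ)) +
        (k / 2 * ((R₁' + speedIntegral u τ / c) ^ 2 *
            sphereNormSq (FluidPDE.curl (u τ)) x₀ (R₁' + speedIntegral u τ / c) +
            (R₂' - speedIntegral u τ / c) ^ 2 *
              sphereNormSq (FluidPDE.curl (u τ)) x₀ (R₂' - speedIntegral u τ / c)) +
          k / R₁' * ∫ x in {x : EuclideanSpace ℝ (Fin 3) | R₁' < ‖x - x₀‖ ∧ ‖x - x₀‖ < R₂'},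
            ‖FluidPDE.curl (u τ) x‖ ^ 2)) := by
    rw [intervalIntegral.integral_add (f := fun τ => -localisedEnstrophyDissipation (movingCutoff x₀ k
      (fun t => R₁' + speedIntegral u t / c) (fun t => R₂' - speedIntegral u t / c) τ) (u τ)) hYi.neg hG'i,
      intervalIntegral.integral_neg]
  linarith [hmono, hsplit, hid]

end Integrated


end Literature.Analysis.FluidPDE

end
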